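import Mathlib.Algebra.BigOperators.Fin
import Mathlib.Algebra.BigOperators.Pi
import Mathlib.Data.ZMod.Basic
import Mathlib.Data.Matrix.Mul
import Mathlib.GroupTheory.SpecificGroups.Quaternion
import Mathlib.LinearAlgebra.Dimension.Constructions
import Mathlib.Tactic.FinCases
import Mathlib.Tactic.Ring

/-!
# Dodecic atlas, type `Dic₃`: dicyclic CM fields of degree 12 — the Hodge lattice of the whole `F`-slice, its five atoms, and the minimality `μ ≥ 5` (kernel census)

COR-CM (cell `pub-hodgecm2`), count-neutral kernel census by the binder seat b17 (gen 39; claim DIC3-KERNEL = ask A6-R13-K),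
the kernel certificate of the cell memo DIC3-MU (`HOME/pub-hodgecm2-b17/dic3/DIC3-MU.md`, b17 gen 38: `μ(Dic₃) = 5`,
`H/P ≅ ℤ[i] ⊕ Λ⁴`, carriers).  It extends the ATLAS of lit-andre-3 (`Census/Octic*Species.lean`, the six order-8 types;
`Census/DecicCyclicSpecies.lean`, `ℤ/10`) to the first NON-ABELIAN type of order 12 whose complex conjugation is a square,
with two differences of method: the Hodge lattice is a `Submodule ℤ (Pt → ℤ)` and the lattice theorem / the minimality are
stated as EQUALITIES OF SUBMODULES and as a theorem over ALL finite generating families (not as a parametrisation / a parity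
table), because the rank here is `58`.  No named fact, no geometry, no `sorry`: `decide`, `simp`, `omega` and linear algebra
over `ZMod 2` (`finrank_span_finset_le_card`) only.  HC_CM is not proved anywhere in this cell; nothing here is a headline.

DICTIONARY (cited, not formalised; identical to `Census/OcticQuaternionSpecies.lean`).  `F` a Galois CM field with group
`G = Gal(F/ℚ) = Hom(F, ℚ̄)` and complex conjugation `c ∈ Z(G)`; a CM type of `(G,c)` is `T ⊆ G` with `T ⊔ cT = G`; isogeny
classes of simple CM abelian varieties SPLIT BY `F` ↔ `G`-orbits of CM types under RIGHT translation, the right stabiliser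
`H_T` cuts out the CM field `K = F^{H_T}`, `dim = |G|/2|H_T|`, eigen-labels of `H¹` = cosets `G/H_T` = `Hom(K, ℚ̄)`, LEFT
translation = Galois conjugation [cite: Milne1999, Prop. 2.1 and the paragraph after it, p. 54]; a class monomial on a product
of powers of the factors with exponent vector `m ≥ 0` is a Hodge class iff all Pohlmann forms `hodgeForm g m` vanish
[cite: Pohlmann1968, Thm 1]; the conjugate pairs `{x, cx}` are the divisor classes.

THIS TYPE.  `G = Dic₃ = ⟨a, x | a⁶ = 1, x² = a³ = c, xax⁻¹ = a⁻¹⟩` (order 12; Mathlib's `QuaternionGroup 3`, `c = a 3`), e.g.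
`F = F⁺K₀` with `F⁺` a totally real Galois `S₃`-sextic and `K₀` a cyclic quartic CM field containing the quadratic subfield of
`F⁺` (`Gal(F/ℚ) = S₃ ×_{C₂} C₄ ≅ Dic₃`, `c = (1, 2)` central); `F` has exactly one proper CM subfield, the CYCLIC QUARTIC
`K₀ = F^⟨a²⟩` (`G/⟨a²⟩ ≅ ℤ/4`), NO sextic CM subfield (the only involution of `Dic₃` is `c`) and NO imaginary quadratic subfield.
`types_census`: `64` CM types = `4` (one right orbit with stabiliser `⟨a²⟩`: the CM abelian SURFACE `S` with CM by `K₀`) `+ 5·12`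
(five primitive types: SIXFOLDS `B₁,…,B₅` with CM by `F`, pairwise non-isogenous).  Labels (`Pt`, 64): `s u`, `u ∈ ℤ/4 = G/⟨a²⟩`,
and `q b g`, `g ∈ G` (block `B_{b+1}`); `act` = left multiplication (through `eps : G → ℤ/4` on the `S`-labels); `phi` = the
total type (`labels_census`).  The slice is the family of all `S^{n₀} × B₁^{n₁} × ⋯ × B₅^{n₅}`.
NUMBERS (exact oracle, recomputed twice: b17 g38 `dic3/model.py`, this seat `dic3k/qmodel.py`; cross-checked against
lit-andre-3 g8 `closure_slice.py`): Pohlmann forms of rank `6` (twelve vectors, `h_{cg} = −h_g`), Hodge lattice `H` of rank `58`,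
`32` conjugate pairs (`P`, rank `32`), `M = H/P ≅ ℤ²⁶` with `c = −1`; no Hodge monomial outside `P` on any carrier of dimension
`≤ 5` (`S`, `S²`), none on any power `Sⁿ`, `B_bⁿ` (all six factors nondegenerate); atoms first appear in dimension `8`
(`S × B_b`, `b ≤ 3`) and `12` (`B_b × B_b'`).

KERNEL, THIS FILE.  `types_census`, `labels_census`, `sanity` · `hodgeLattice` (`Submodule ℤ`), `mem_hodgeLattice` ·
`pairs` (`P`), `atoms` (`A = Σ_{k<5} ℤ[G]·atom_k` for the five `orbitRep`), `atom_census` (Künneth types, carriers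
`(14,14,14,12,12)`, orbit sizes `12`) · `pairs_le`, `atoms_le` (`P, A ≤ H`) · `parity` (the five `B`-block parities
`ℤ^{64} → 𝔽₂⁵`, `ℤ`-linear, `G`-invariant `parity_transl`, zero on pairs `parity_pairVec`, ONTO on `H` `parity_unitWitness`) ·
**`five_le_card_of_generates`**: for every finite family `S ⊂ ℤ^{64}` with `H ≤ P + Σ_{t ∈ S} ℤ[G]·t` one has `|S| ≥ 5`.
KERNEL, SEQUEL `Census/DodecicDicyclicLattice.lean`: **`lattice_theorem : hodgeLattice = pairs ⊔ atoms`** (`H = P + Σ_{k<5}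
ℤ[G]·atom_k`, a `decide`-checked integer certificate), hence `μ(Dic₃) = 5` exactly.

THE FIVE ATOMS (`orbitRep`, = family `F*` of DIC3-MU §4, the lexicographically minimal carrier profile `(14,14,14,12,12)` among
all five-orbit generating families — exhaustive oracle DIC3-MU Thm C / kit jobs j131081, j131589, not re-decided here):
`R₀` on `S × B₂ × B₃` (Künneth `(1,3,2)`, codimension 3), `R₁` on `S × B₄ × B₅` (`(2,1,1)`, codimension 2), `R₂` on
`S × B₁ × B₅` (`(1,1,2)`, codimension 2), `R₃` on `B₂ × B₅` and `R₄` on `B₃ × B₄` (`(3,3)`, codimension 3); the `S × B × B'`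
atoms are graphs of morphisms of `ℚ`-Hodge structures out of `H¹(S)` into Künneth pieces of `H*(B) ⊗ H*(B')`, the `B × B'`
atoms are classes in `H³(B) ⊗ H³(B')`.  STRUCTURE (DIC3-MU Thms A–B, informal here): `Λ := ℤ[G]/(c+1)` is the pullback order
`ℤ[i] ×_{𝔽₉} O`, `O` the maximal order of the quaternion algebra `(−1,−3)_ℚ`; `M ≅ ℤ[i] ⊕ Λ⁴` as a `Λ`-lattice, so `M` needs
exactly `5` generators; in the kernel the lower bound is the `𝔽₂`-form `5 = dim (M ⊗ 𝔽₂)_G` (this file) and the upper bound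
the explicit family (sequel).

THEOREM (informal; complete given the operations (O1)–(O4) of `Census/DihedralFourCoreLattice.lean`, whose inputs are cited
there; the same shape as the octic/decic rows).  Let `Z` be ANY abelian variety isogenous to a product of powers of
`S, B₁, …, B₅`.  If for each `k < 5` ONE algebraic class on the carrier `Y_k` of `R_k` (three explicit CM `14`-folds, two explicit
CM `12`-folds) has a non-zero component on the eigen-line of `R_k`, then every Hodge class on `Z` is algebraic; and no family of
fewer than five Galois orbits of Hodge monomials generates the Hodge ring of the slice together with the divisors
(`five_le_card_of_generates`).  `F` has no imaginary quadratic subfield, so none of the atoms is a Weil class of a Weil-type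
abelian variety in the classical sense and the known fourfold/sixfold Weil-class theorems do not enter (DIC3-MU §6; the
"Markman column" of the order-12 rows is lit-andre-3's ask A6-R24, not treated here).  Open in print as far as the seat knows.

## References
* [Pohlmann1968] H. Pohlmann, Algebraic cycles on abelian varieties of complex multiplication type, Ann. of Math. 88 (1968), Thm 1.
* [Milne1999] J. S. Milne, Lefschetz motives and the Tate conjecture, Compositio Math. 117 (1999), Prop. 2.1, p. 54.

## Provenance
Exact oracles (seat folder `work/dic3k/`, copies in `HOME/pub-hodgecm2-b17/dic3k/`): `qmodel.py` (the slice model in Mathlib's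
`QuaternionGroup` convention, cross-check with b17 g38 `dic3/model.py` and family `F*` = `family5_minimal_profile.json`),
`cert1–7.py` (saturation of the form lattice, the exceptional set `E`, the basis `hb`, syzygy-reduced combinations),
`gen_lean.py` (this file and the sequel are generated verbatim from `data.json`).
-/

namespace Summit.HodgeConjecture.CorCM.Census.DodecicDicyclicSpecies

open Finset QuaternionGroup

/-! ## The group `Dic₃`, its CM types and the simple factors -/

/-- `G = Dic₃`, the dicyclic group of order `12`, realised as Mathlib's `QuaternionGroup 3` (`a i`, `xa i`, `i ∈ ℤ/6`;
`x² = a³ = c` is the central involution). [folklore] -/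
abbrev G := QuaternionGroup 3

/-- The CM types of `(G,c)` as subsets `T ⊆ G`: for every `g` exactly one of `g`, `cg` lies in `T`. [folklore] -/
def cmTypes : Finset (Finset G) := univ.powerset.filter fun T => ∀ g : G, g ∈ T ↔ (a 3 : G) * g ∉ T

/-- The CM types of the simple factors (one representative per factor, as subsets of `G = Hom(F, ℚ̄)`): index `0` is the
type of the SURFACE `S` (induced from the cyclic quartic CM subfield `K₀ = F^⟨a²⟩`), indices `1, …, 5` the five primitive types
(the SIXFOLDS `B₁, …, B₅`). [folklore] -/
def blockType : Fin 6 → Finset G :=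
  ![{a 0, a 2, a 4, xa 0, xa 2, xa 4},
    {a 0, a 1, a 2, xa 0, xa 4, xa 5},
    {a 0, a 1, a 2, xa 0, xa 1, xa 5},
    {a 0, a 1, a 5, xa 0, xa 1, xa 5},
    {a 0, a 1, a 2, xa 0, xa 2, xa 4},
    {a 0, a 1, a 5, xa 0, xa 2, xa 4}]

set_option maxRecDepth 20000 in
/-- **Types census.**  `(G,c)` has exactly `64` CM types; they are exactly the right translates `T·g` (same complex torus, CM
structure twisted by `g`) of the six block types; the right stabilisers are `⟨a²⟩ = {a⁰, a², a⁴}` for the surface type and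
trivial for the five primitive types; the orbit sizes are `4` and `12, …, 12` (`4 + 5·12 = 64`, so the orbits are disjoint: the
six simple factors are pairwise non-isogenous and exhaust the simple CM abelian varieties split by `F`; `dim S = 12/(2·3) = 2`,
`dim B_b = 6`). [folklore] -/
theorem types_census : cmTypes.card = 64 ∧
    cmTypes = (univ ×ˢ (univ : Finset (Fin 6))).image (fun p => (blockType p.2).image (fun t => t * p.1)) ∧
    (univ.filter fun g : G => (blockType 0).image (fun t => t * g) = blockType 0) = {a 0, a 2, a 4} ∧
    (∀ b : Fin 5, (univ.filter fun g : G => (blockType b.succ).image (fun t => t * g) = blockType b.succ) = {a 0}) ∧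
    (univ.image fun g : G => (blockType 0).image (fun t => t * g)).card = 4 ∧
    (∀ b : Fin 5, (univ.image fun g : G => (blockType b.succ).image (fun t => t * g)).card = 12) := by
  refine ⟨by decide +kernel, by decide +kernel, by decide +kernel, by decide +kernel, by decide +kernel, by decide +kernel⟩

/-! ## Labels (CM eigen-lines of `H¹` of the factors), the Galois action, the total type -/

/-- Labels of the CM eigenvectors: `s u` (`u ∈ ℤ/4 ≅ G/⟨a²⟩ = Hom(K₀, ℚ̄)`, the surface) and `q b g` (`g ∈ G = Hom(F, ℚ̄)`, the
sixfold `B_{b+1}`); `64 = 4 + 5·12` labels. [folklore] -/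
abbrev Pt := ZMod 4 ⊕ (Fin 5 × G)

/-- `s u`: the eigen-label `u ∈ G/⟨a²⟩ ≅ ℤ/4` of the surface `S`. [folklore] -/
abbrev s (u : ZMod 4) : Pt := Sum.inl u

/-- `q b g`: the eigen-label `g ∈ G` of the sixfold `B_{b+1}`. [folklore] -/
abbrev q (b : Fin 5) (g : G) : Pt := Sum.inr (b, g)

/-- The quotient map `G → G/⟨a²⟩ ≅ ℤ/4` (`a ↦ 2`, `x ↦ 1`; a homomorphism with kernel `{a⁰, a², a⁴}`, see `labels_census`):
the coset `g⟨a²⟩`, i.e. the restriction of the embedding `g` to `K₀`. [folklore] -/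
def eps : G → ZMod 4
  | a i => if i.val % 2 = 0 then 0 else 2
  | xa i => if i.val % 2 = 0 then 1 else 3

/-- `G` acts on the labels by LEFT multiplication (Galois conjugation of eigenvectors / of coefficients). [folklore] -/
def act (g : G) : Pt → Pt
  | Sum.inl u => Sum.inl (eps g + u)
  | Sum.inr (b, h) => Sum.inr (b, g * h)

/-- The total CM type `Φ` (labels of Hodge type `(1,0)`), block by block: `s u ∈ Φ` iff the coset `u` lies in the surface
type, `q b g ∈ Φ` iff `g ∈ blockType (b+1)` (`labels_census`). [folklore] -/
def phi : Finset Pt := {s 0, s 1, q 0 (a 0), q 0 (a 1), q 0 (a 2), q 0 (xa 0), q 0 (xa 4), q 0 (xa 5), q 1 (a 0), q 1 (a 1), q 1 (a 2), q 1 (xa 0), q 1 (xa 1), q 1 (xa 5),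
  q 2 (a 0), q 2 (a 1), q 2 (a 5), q 2 (xa 0), q 2 (xa 1), q 2 (xa 5), q 3 (a 0), q 3 (a 1), q 3 (a 2), q 3 (xa 0), q 3 (xa 2), q 3 (xa 4), q 4 (a 0), q 4 (a 1), q 4 (a 5), q 4 (xa 0), q 4 (xa 2), q 4 (xa 4)}

/-- `Φ` is a CM type for `c = a³`, and `act` is a left action (closed sanity check). [folklore] -/
theorem sanity : (∀ x : Pt, x ∈ phi ↔ act (a 3) x ∉ phi) ∧ (∀ g h : G, ∀ x : Pt, act (g * h) x = act g (act h x)) ∧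
    (∀ x : Pt, act 1 x = x) := by
  refine ⟨by decide, by decide, by decide⟩

/-- **Labels census**: `eps` is a homomorphism onto `ℤ/4` with kernel `⟨a²⟩` (so the `S`-labels are the cosets
`G/⟨a²⟩ = Hom(K₀, ℚ̄)` with the induced Galois action), and `Φ` is the total type induced by the block types:
`s (eps g) ∈ Φ ↔ g ∈ blockType 0`, `q b g ∈ Φ ↔ g ∈ blockType (b+1)`. [folklore] -/
theorem labels_census : (∀ g h : G, eps (g * h) = eps g + eps h) ∧
    (univ.filter fun g : G => eps g = 0) = {a 0, a 2, a 4} ∧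
    (∀ g : G, s (eps g) ∈ phi ↔ g ∈ blockType 0) ∧ (∀ b : Fin 5, ∀ g : G, q b g ∈ phi ↔ g ∈ blockType b.succ) := by
  refine ⟨by decide, by decide, by decide, by decide⟩

/-! ## Pohlmann's Hodge forms and the Hodge lattice -/

/-- Pohlmann's Hodge functional of `g ∈ G` on integer exponent vectors `m : Pt → ℤ` of power-products of the simple factors:
`Σ_x (2[g·x ∈ Φ] − 1) m_x`; an `m ≥ 0` is the exponent vector of a Hodge monomial iff all twelve vanish. [cite: Pohlmann1968, Thm 1] -/
def hodgeForm (g : G) (m : Pt → ℤ) : ℤ := ∑ x : Pt, (if act g x ∈ phi then m x else -m x)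

/-- Block types as a Boolean table (labels `q b (a i)`): entry `(b, i)` = `[a i ∈ blockType (b+1)]` (kernel-fast). [folklore] -/
def tA : Fin 5 → Fin 6 → Bool :=
  ![![true, true, true, false, false, false],
    ![true, true, true, false, false, false],
    ![true, true, false, false, false, true],
    ![true, true, true, false, false, false],
    ![true, true, false, false, false, true]]

/-- Block types as a Boolean table (labels `q b (xa i)`): entry `(b, i)` = `[xa i ∈ blockType (b+1)]`. [folklore] -/
def tX : Fin 5 → Fin 6 → Bool :=
  ![![true, false, false, false, true, true],
    ![true, true, false, false, false, true],
    ![true, true, false, false, false, true],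
    ![true, false, true, false, true, false],
    ![true, false, true, false, true, false]]

/-- Boolean membership in `Φ` (kernel-fast twin of `· ∈ phi`, see `inPhi_iff`). [folklore] -/
def inPhi : Pt → Bool
  | Sum.inl u => decide (u = 0 ∨ u = 1)
  | Sum.inr (b, a i) => tA b i
  | Sum.inr (b, xa i) => tX b i

/-- `inPhi` decides membership in `Φ`. [folklore] -/
theorem inPhi_iff : ∀ x : Pt, inPhi x = true ↔ x ∈ phi := by decide

/-- The coefficient vector `(2[g·x ∈ Φ] − 1)_x ∈ {±1}^{64}` of Pohlmann's form `hodgeForm g`. [cite: Pohlmann1968, Thm 1] -/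
def hodgeVec (g : G) (x : Pt) : ℤ := if inPhi (act g x) then 1 else -1

/-- `hodgeVec` in terms of `Φ`. [folklore] -/
theorem hodgeVec_apply (g : G) (x : Pt) : hodgeVec g x = if act g x ∈ phi then 1 else -1 := by
  unfold hodgeVec
  by_cases h : act g x ∈ phi
  · simp [h, (inPhi_iff (act g x)).mpr h]
  · have h' : inPhi (act g x) ≠ true := fun h'' => h ((inPhi_iff _).mp h'')
    simp [h, h']

/-- Pohlmann's form is the dot product with its coefficient vector. [folklore] -/
theorem hodgeForm_eq (g : G) (m : Pt → ℤ) : hodgeForm g m = hodgeVec g ⬝ᵥ m := by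
  unfold hodgeForm dotProduct
  refine Finset.sum_congr rfl fun x _ => ?_
  rw [hodgeVec_apply]
  by_cases hx : act g x ∈ phi <;> simp [hx]

/-- **The Hodge lattice** `H ⊂ ℤ^{64}` of the whole `F`-slice: the integer exponent vectors on which all twelve Pohlmann forms
vanish (its points `m ≥ 0` are exactly the exponent vectors of Hodge monomials on products of powers of `S, B₁, …, B₅`; rank `58`
by the oracle). [cite: Pohlmann1968, Thm 1] -/
def hodgeLattice : Submodule ℤ (Pt → ℤ) where
  carrier := {m | ∀ g : G, hodgeVec g ⬝ᵥ m = 0}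
  zero_mem' := by intro g; simp
  add_mem' := by
    intro m m' hm hm' g
    rw [dotProduct_add, hm g, hm' g, add_zero]
  smul_mem' := by
    intro c m hm g
    rw [dotProduct_smul, hm g, smul_zero]

/-- Membership in the Hodge lattice = vanishing of all Pohlmann forms. [folklore] -/
theorem mem_hodgeLattice (m : Pt → ℤ) : m ∈ hodgeLattice ↔ ∀ g : G, hodgeForm g m = 0 := by
  simp only [hodgeForm_eq]; rfl

/-- The conjugate pair through a label, as an exponent vector (a divisor-class monomial `e_x ∧ e_{cx}`). [folklore] -/
def pairVec (x : Pt) (y : Pt) : ℤ := if y = x ∨ y = act (a 3) x then 1 else 0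

/-- The divisor sublattice `P = ℤ⟨32 conjugate pairs⟩` (Lefschetz `(1,1)`: `NS ⊗ ℚ̄` of the factors). [folklore] -/
def pairs : Submodule ℤ (Pt → ℤ) := Submodule.span ℤ (Set.range pairVec)

/-- Galois translate of an exponent vector: `(g·v)(y) = v(g⁻¹·y)` (the conjugate monomial). [folklore] -/
def transl (g : G) (v : Pt → ℤ) (y : Pt) : ℤ := v (act g⁻¹ y)

/-- Representatives of the FIVE atom orbits = the family `F*` of the cell memo DIC3-MU §4: atoms `0, 1, 2` on the `14`-folds
`S × B₂ × B₃`, `S × B₄ × B₅`, `S × B₁ × B₅` (Künneth types `(1,3,2)`, `(2,1,1)`, `(1,1,2)`; codimension `3, 2, 2`), atoms `3, 4` on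
the `12`-folds `B₂ × B₅`, `B₃ × B₄` (types `(3,3)`, codimension `3`); every orbit has `12` elements (`atom_census`). [folklore] -/
def orbitRep : Fin 5 → Finset Pt :=
  ![{s 2, q 1 (a 3), q 1 (xa 3), q 1 (xa 5), q 2 (a 5), q 2 (xa 1)},
    {s 0, s 1, q 3 (xa 5), q 4 (xa 1)},
    {s 3, q 0 (a 3), q 4 (a 5), q 4 (xa 2)},
    {q 1 (a 5), q 1 (xa 2), q 1 (xa 4), q 4 (a 0), q 4 (a 1), q 4 (xa 0)},
    {q 2 (a 5), q 2 (xa 1), q 2 (xa 5), q 3 (a 3), q 3 (a 4), q 3 (xa 3)}]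

/-- The atom monomials as exponent vectors. [folklore] -/
def atomVec (k : Fin 5) (y : Pt) : ℤ := if y ∈ orbitRep k then 1 else 0

/-- The atom sublattice `A = Σ_{k<5} ℤ[G]·atom_k` (all Galois translates of the five atoms). [folklore] -/
def atoms : Submodule ℤ (Pt → ℤ) := Submodule.span ℤ (Set.range fun p : G × Fin 5 => transl p.1 (atomVec p.2))

/-- The block of a label: `0` for the surface, `b+1` for `B_{b+1}`. [folklore] -/
def blockOf : Pt → Fin 6
  | Sum.inl _ => 0
  | Sum.inr (b, _) => b.succ

/-- **Atom census**: Künneth types (numbers of labels in the blocks `S, B₁, …, B₅`; the carriers are `S^{[n₀>0]} × ∏ B_b^{[n_b>0]}`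
of dimensions `14, 14, 14, 12, 12` — the lexicographically minimal carrier profile of a five-orbit generating family by the
exhaustive oracle DIC3-MU Thm C, not re-decided here) and orbit sizes `12`. [folklore] -/
theorem atom_census :
    (∀ k : Fin 5, (fun j : Fin 6 => ((orbitRep k).filter fun x => blockOf x = j).card) = (![![1, 0, 3, 2, 0, 0], ![2, 0, 0, 0, 1, 1], ![1, 1, 0, 0, 0, 2], ![0, 0, 3, 0, 0, 3], ![0, 0, 0, 3, 3, 0]] : Fin 5 → Fin 6 → ℕ) k) ∧
    (∀ k : Fin 5, (univ.image fun g : G => (orbitRep k).image (act g)).card = 12) := by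
  refine ⟨by decide, by decide⟩

set_option maxRecDepth 20000 in
/-- Every conjugate pair is a Hodge vector. [folklore] -/
theorem pairVec_hodge : ∀ x : Pt, ∀ g : G, hodgeVec g ⬝ᵥ pairVec x = 0 := by
  decide +kernel

set_option maxRecDepth 20000 in
/-- Every Galois translate of every atom is a Hodge vector. [folklore] -/
theorem atom_hodge : ∀ h g : G, ∀ k : Fin 5, hodgeVec g ⬝ᵥ transl h (atomVec k) = 0 := by
  decide +kernel

/-- `P ≤ H`. [folklore] -/
theorem pairs_le : pairs ≤ hodgeLattice :=
  Submodule.span_le.mpr (by rintro _ ⟨x, rfl⟩ g; exact pairVec_hodge x g)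

/-- `A ≤ H`. [folklore] -/
theorem atoms_le : atoms ≤ hodgeLattice :=
  Submodule.span_le.mpr (by rintro _ ⟨p, rfl⟩ g; exact atom_hodge p.1 g p.2)

/-- Atoms are in `A`. [folklore] -/
theorem atomVec_mem (k : Fin 5) : atomVec k ∈ atoms := by
  have h : transl 1 (atomVec k) = atomVec k := by
    funext y; simp only [transl, inv_one, sanity.2.2 y]
  exact h ▸ Submodule.subset_span ⟨(1, k), rfl⟩

/-! ## Minimality: no four Galois orbits generate (`μ(Dic₃) ≥ 5`) -/

/-- The five `B`-block parities `m ↦ (Σ_g m(q b g) mod 2)_b`, a `ℤ`-linear map `ℤ^{64} → 𝔽₂⁵`. [folklore] -/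
def parity : (Pt → ℤ) →ₗ[ℤ] (Fin 5 → ZMod 2) where
  toFun m := fun b => ∑ g : G, ((m (q b g) : ℤ) : ZMod 2)
  map_add' m m' := by
    funext b
    simp only [Pi.add_apply, Int.cast_add, Finset.sum_add_distrib]
  map_smul' c m := by
    funext b
    simp only [Pi.smul_apply, smul_eq_mul, Int.cast_mul, RingHom.id_apply, ← Finset.mul_sum, zsmul_eq_mul]

/-- The parities vanish on conjugate pairs (each pair lies in one block). [folklore] -/
theorem parity_pairVec : ∀ x : Pt, parity (pairVec x) = 0 := by
  decide

/-- The parities are Galois invariant (each block is `G`-stable). [folklore] -/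
theorem parity_transl (g : G) (v : Pt → ℤ) : parity (transl g v) = parity v := by
  funext b
  show ∑ h : G, ((v (act g⁻¹ (q b h)) : ℤ) : ZMod 2) = ∑ h : G, ((v (q b h) : ℤ) : ZMod 2)
  exact Fintype.sum_equiv (Equiv.mulLeft g⁻¹) _ _ (fun h => rfl)

/-- Hodge vectors whose parity vectors are the five unit vectors (sums of atoms). [folklore] -/
def unitWitness : Fin 5 → (Pt → ℤ) := ![atomVec 2, atomVec 0, atomVec 0 + atomVec 1 + atomVec 3 + atomVec 4, atomVec 0 + atomVec 1 + atomVec 3, atomVec 0 + atomVec 3]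

/-- The witnesses realise the unit vectors of `𝔽₂⁵`: `parity` maps `H` onto `𝔽₂⁵`. [folklore] -/
theorem parity_unitWitness : ∀ b : Fin 5, parity (unitWitness b) = Pi.single b 1 := by
  decide

/-- The witnesses are Hodge vectors. [folklore] -/
theorem unitWitness_mem (b : Fin 5) : unitWitness b ∈ hodgeLattice := by
  have hA : ∀ k, atomVec k ∈ hodgeLattice := fun k => atoms_le (atomVec_mem k)
  fin_cases b <;> simp only [unitWitness] <;>
    repeat (first | exact hA _ | refine Submodule.add_mem _ ?_ ?_)

/-- **MINIMALITY (`μ(Dic₃) ≥ 5`).**  If the Hodge lattice is generated, together with the divisor classes, by the Galois translates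
of a finite family `S` of integer vectors, then `|S| ≥ 5`: the parity map is `G`-invariant, kills the pairs and maps `H` ONTO
`𝔽₂⁵` (`parity_unitWitness`), while the image of `P + Σ_{t ∈ S} ℤ[G]·t` is spanned over `𝔽₂` by the `|S|` vectors `parity(S)`.
(Cell memo DIC3-MU: `5 = dim_{𝔽₂} (H/P ⊗ 𝔽₂)_G = dim_{𝔽₉} M/𝔪M`; with `lattice_theorem` of the sequel, `μ(Dic₃) = 5` exactly.) [folklore] -/
theorem five_le_card_of_generates (S : Finset (Pt → ℤ))
    (hS : hodgeLattice ≤ pairs ⊔ Submodule.span ℤ {v | ∃ g : G, ∃ t ∈ S, v = transl g t}) : 5 ≤ S.card := by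
  classical
  let T : Finset (Fin 5 → ZMod 2) := S.image parity
  let W : Submodule ℤ (Fin 5 → ZMod 2) := (Submodule.span (ZMod 2) (T : Set (Fin 5 → ZMod 2))).restrictScalars ℤ
  have hle : pairs ⊔ Submodule.span ℤ {v | ∃ g : G, ∃ t ∈ S, v = transl g t} ≤ W.comap parity := by
    refine sup_le (Submodule.span_le.mpr ?_) (Submodule.span_le.mpr ?_)
    · rintro _ ⟨x, rfl⟩
      simp [W, parity_pairVec x]
    · rintro _ ⟨g, t, ht, rfl⟩
      have hmem : parity t ∈ (T : Set (Fin 5 → ZMod 2)) := by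
        simpa [T] using Finset.mem_image_of_mem parity ht
      simpa [W, parity_transl] using Submodule.subset_span hmem
  have hunit : ∀ b : Fin 5, (Pi.single b 1 : Fin 5 → ZMod 2) ∈ Submodule.span (ZMod 2) (T : Set (Fin 5 → ZMod 2)) := by
    intro b
    have h := hle (hS (unitWitness_mem b))
    simpa [W, parity_unitWitness b] using h
  have htop : Submodule.span (ZMod 2) (T : Set (Fin 5 → ZMod 2)) = ⊤ := by
    refine Submodule.eq_top_iff'.mpr fun w => ?_
    rw [pi_eq_sum_univ' w]
    exact Submodule.sum_mem _ fun b _ => Submodule.smul_mem _ _ (hunit b)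
  have h1 : Module.finrank (ZMod 2) (Submodule.span (ZMod 2) (T : Set (Fin 5 → ZMod 2))) ≤ T.card :=
    finrank_span_finset_le_card T
  rw [htop, finrank_top, Module.finrank_fin_fun] at h1
  exact h1.trans Finset.card_image_le

end Summit.HodgeConjecture.CorCM.Census.DodecicDicyclicSpecies
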